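import Mathlib.Algebra.Group.Submonoid.Operations
import Mathlib.Algebra.Group.Subgroup.Basic
import Mathlib.Algebra.Module.Submodule.Basic
import Mathlib.Data.Int.Basic
import Mathlib.Logic.Function.Basic
import HarnessLib

/-!
# [IUTchIII] Proposition 3.5: Kummer theory and upper semi-compatibility for vertically coric
# local LGP-monoids (abc-iut cell, layer L6, slice [IUTchIII] §3)

S. Mochizuki, *Inter-universal Teichmüller theory III*, kurims manuscript (May 2020) of PRIMS
**57** (2021), §3, Proposition 3.5 pp. 103–106 (PRIMS offset ≈ +420). Proposition 3.5 is a
CONSTRUCTION ("functorial algorithm … for constructing") inside one column of a Gaussian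
log-theta-lattice; its inputs (𝒟-Θ^{±ell}NF-Hodge theaters, the monoids `Ψ_cns(^{n,∘}𝔇_≻)_t` and
Kummer isomorphisms of [IUTchII] Cor. 4.5 (iii), 4.6 (iii), the log-links of [IUTchIII] Def. 1.1
and the vertical coricity of Thm. 1.5 (i)) are owned by other seats (abc-iut-L5-t4, L6-t2, L6-t3).
STATEMENTS-FIRST typing records (i) as an OUTPUT SIGNATURE (`VerticallyCoricLGPData`: data fields
= named outputs incl. the Kummer isomorphisms as `MulEquiv`s) and (ii) (a), (b), (c) and the
concluding "log-Kummer correspondence" as `Prop`-valued definitions over abstract data (sets,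
Kummer maps, log-link iterates as partial maps), each quoting the printed clause. One clause is
PROVED outright (`iUnion_range_shift`: translation-invariance of a `ℤ`-indexed union is formal).
Tag form [claim: Mochizuki2012, status: disputed] (D-0012 claim key).
-/

namespace Literature.IUT.LogThetaLattice

universe u v w

/-! ### Proposition 3.5: vertically coric local LGP-monoids, Kummer theory, upper semi-compatibility -/

section Prop35

variable (lstar : ℕ) (V : Type v) (isBad : V → Prop)

/-- OUTPUT SIGNATURE of [IUTchIII] Proposition 3.5 (i) "(Vertically Coric Local LGP-Monoids and
Associated Kummer Theory)", pp. 103–104, for one column `n` of a Gaussian log-theta-lattice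
`{^{n,m}𝓗𝓣}_{n,m∈ℤ}`: "a functorial algorithm in the 𝒟-Θ^{±ell}NF-Hodge theater `^{n,∘}𝓗𝓣^{𝒟-Θ±ell NF}`
for constructing [collections of] monoids `𝕍 ∋ v ↦ Ψ_LGP(^{n,∘}𝓗𝓣)_v`; `𝕍 ∋ v ↦ _∞Ψ_LGP(^{n,∘}𝓗𝓣)_v` …
which we refer to as vertically coric [local] LGP-monoids", together with, "for each `n, m ∈ ℤ`,
Kummer isomorphisms of [collections of] monoids `Ψ_{𝓕_LGP}(^{n,m}𝓗𝓣)_v ≅ Ψ_LGP(^{n,∘}𝓗𝓣)_v`;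
`_∞Ψ_{𝓕_LGP}(^{n,m}𝓗𝓣)_v ≅ _∞Ψ_LGP(^{n,∘}𝓗𝓣)_v`" compatible with Proposition 3.4 (ii). The ambient
(étale-like) rings `R v j` stand for `log(^{S^±_{j+1},j}𝓕(^{n,∘}𝔇_≻)_v)`; the Frobenius-like monoids
at `(n,m)` live in rings `Rm m v j`. [claim: Mochizuki2012, status: disputed] -/
structure VerticallyCoricLGPData (R : V → Fin lstar → Type u) [∀ v j, CommRing (R v j)]
    (Rm : ℤ → V → Fin lstar → Type u) [∀ m v j, CommRing (Rm m v j)] where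
  /-- `Ψ_LGP(^{n,∘}𝓗𝓣^{𝒟-Θ±ell NF})_v`, component `j` (vertically coric, étale-like) -/
  Ψcoric : ∀ v j, Submonoid (R v j)
  /-- `_∞Ψ_LGP(^{n,∘}𝓗𝓣^{𝒟-Θ±ell NF})_v`, component `j` -/
  ΨcoricInf : ∀ v j, Submonoid (R v j)
  /-- `Ψ_{𝓕_LGP}(^{n,m}𝓗𝓣)_v`, component `j` (Frobenius-like, Proposition 3.4 (ii)) -/
  ΨF : ∀ m v j, Submonoid (Rm m v j)
  /-- `_∞Ψ_{𝓕_LGP}(^{n,m}𝓗𝓣)_v`, component `j` -/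
  ΨFInf : ∀ m v j, Submonoid (Rm m v j)
  /-- the Kummer isomorphism `Ψ_{𝓕_LGP}(^{n,m}𝓗𝓣)_v ≅ Ψ_LGP(^{n,∘}𝓗𝓣)_v` (p. 104, last display) -/
  kummer : ∀ m v j, ΨF m v j ≃* Ψcoric v j
  /-- the Kummer isomorphism `_∞Ψ_{𝓕_LGP}(^{n,m}𝓗𝓣)_v ≅ _∞Ψ_LGP(^{n,∘}𝓗𝓣)_v` -/
  kummerInf : ∀ m v j, ΨFInf m v j ≃* ΨcoricInf v j
  /-- for `v ∈ 𝕍^bad`: the vertically coric splitting monoid `Ψ^⊥_LGP(−)_v ⊆ Ψ_LGP(−)_v`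
  (Proposition 3.5 (ii) (c), p. 105) -/
  ΨcoricSplit : ∀ v, isBad v → ∀ j, Submonoid (R v j)
  /-- the splitting monoid is a submonoid -/
  coricSplit_le : ∀ v (h : isBad v) j, ΨcoricSplit v h j ≤ Ψcoric v j

/-- [IUTchIII] Proposition 3.5 (ii) (a) "(Nonarchimedean Primes)", pp. 104–105, typed over abstract
data: for `v_ℚ ∈ 𝕍_ℚ^non` and `j ∈ {0, …, l^⋇}`, "the topological module `𝓘(^{S^±_{j+1}}𝓕(^{n,∘}𝔇_≻)_{v_ℚ})`
… contains the images of the submodules of Galois invariants … of the groups of units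
`(Ψ_cns(^{n,m}𝔉_≻)_{|t|})^×_v`, for `𝕍 ∋ v | v_ℚ` and `|t| ∈ {0, …, j}`, via both (1) the tensor
product, over such `|t|`, of the [relevant] Kummer isomorphisms of (i), and (2) the tensor product,
over such `|t|`, of the pre-composite of these Kummer isomorphisms with the `m'`-th iterates … of
the log-links, for `m' ≥ 1`, of the `n`-th column". Data: the coric shell `I` in the ambient module
`X`; for each `m` the invariant unit group `U m` with its Kummer map `κ m : U m → X` (tensor product
over `|t|` already formed); the `m'`-th log-iterate pre-composites as PARTIAL maps `λ m m'`
(defined where the iterate is, cf. Remark 1.1.1). [claim: Mochizuki2012, status: disputed] -/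
def Prop35ii_a {X : Type u} (I : Set X) (U : ℤ → Type w) (κ : ∀ m, U m → X)
    (lam : ∀ m (m' : ℕ), 1 ≤ m' → U m → Option X) : Prop :=
  (∀ m (u : U m), κ m u ∈ I) ∧
    ∀ m m' (h : 1 ≤ m') (u : U m) (x : X), lam m m' h u = some x → x ∈ I

/-- [IUTchIII] Proposition 3.5 (ii) (b) "(Archimedean Primes)", p. 105, typed over abstract data:
for `v_ℚ ∈ 𝕍_ℚ^arc`, "the closed unit ball `𝓘(^{S^±_{j+1}}𝓕(^{n,∘}𝔇_≻)_{v_ℚ})` … contains the image, via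
the tensor product, over `|t| ∈ {0, …, j}`, of the [relevant] Kummer isomorphisms of (i), of both (1)
the groups of units `(Ψ_cns(^{n,m}𝔉_≻)_{|t|})^×_v` … and (2) the closed balls of radius `π` inside
`(Ψ_cns(^{n,m}𝔉_≻)_{|t|})^{gp}_v`"; moreover "a closed ball as in (2) contains, for each `m' ≥ 1`, a
subset that surjects, via the `m'`-th iterate of the log-link …, onto the subset of the group of
units `(Ψ_cns(^{n,m-m'}𝔉_≻)_{|t|})^×_v` on which this iterate is defined". Data: unit groups `U m ⊆`
groupifications `G m`, the radius-`π` balls `B m ⊆ G m`, Kummer maps `κ m : G m → X`, and the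
log-iterates as partial maps `G m → G (m - m')` with domain of definition `Dom`.
[claim: Mochizuki2012, status: disputed] -/
def Prop35ii_b {X : Type u} (I : Set X) (G : ℤ → Type w) (U B : ∀ m, Set (G m))
    (κ : ∀ m, G m → X) (lam : ∀ m (m' : ℕ), G m → Option (G (m - m')))
    (Dom : ∀ m (m' : ℕ), Set (G m)) : Prop :=
  (∀ m, κ m '' U m ⊆ I) ∧ (∀ m, κ m '' B m ⊆ I) ∧
    ∀ m (m' : ℕ), 1 ≤ m' → ∃ S ⊆ B m,
      {y | ∃ x ∈ S, lam m m' x = some y} = U (m - m') ∩ {y | ∃ x ∈ Dom (m - m') m', y = x}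

/-- [IUTchIII] Proposition 3.5 (ii) (c) "(Bad Primes)", pp. 105–106, typed over abstract data: for
`v ∈ 𝕍^bad`, `j ≠ 0`, "as `m` ranges over the elements of `ℤ`, the actions, via the [relevant]
Kummer isomorphisms of (i), of the various monoids `Ψ^⊥_{𝓕_LGP}(^{n,m}𝓗𝓣)_v` … on the ind-topological
modules `𝓘^ℚ(^{S^±_{j+1},j}𝓕(^{n,∘}𝔇_≻)_v) ⊆ log(^{S^±_{j+1},j}𝓕(^{n,∘}𝔇_≻)_v)` … are mutually compatible,
relative to the log-links of the `n`-th column …, in the sense that the only portions of these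
actions that are possibly related to one another via these log-links are the indeterminacies with
respect to multiplication by roots of unity in the domains of the log-links". Typed reading: all
the splitting monoids act (by multiplication, through their Kummer images in the coric ring `R`)
on `𝓘^ℚ`, and two Kummer images of splitting-monoid elements at consecutive `m`, `m+1` that are
related by the log-link differ by a root of unity of `R`. The relation "related via the log-link"
is the abstract parameter `Rel`. [claim: Mochizuki2012, status: disputed] -/
def Prop35ii_c {R : Type u} [CommRing R] (IQ : Submodule ℤ R) (M : ℤ → Type w)
    [∀ m, Monoid (M m)] (κ : ∀ m, M m →* R) (Rel : ∀ m, M m → M (m + 1) → Prop) : Prop :=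
  (∀ m (x : M m), ∀ a ∈ IQ, κ m x * a ∈ IQ) ∧
    ∀ m (x : M m) (y : M (m + 1)), Rel m x y →
      ∃ ζ : R, (∃ k : ℕ, 0 < k ∧ ζ ^ k = 1) ∧ κ (m + 1) y = ζ * κ m x

/-- [IUTchIII] Proposition 3.5 (ii), final paragraph, p. 106: the **log-Kummer correspondence** —
the groups of units and splitting monoids labelled `(n,m)`, `m ∈ ℤ`, act on the `𝓘^ℚ` labelled
`(n,∘)` "not via a single Kummer isomorphism … but rather via the totality of the various
pre-composites of Kummer isomorphisms with iterates … of the log-links", and this `𝓘^ℚ` "is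
invariant with respect to the translation symmetries … of the `n`-th column". Typed: a `ℤ`-indexed
family of actions on one coric module together with invariance of the acted-upon set under the
shift `m ↦ m + 1` of labels (the family of images is the same for `m` and `m + 1`).
[claim: Mochizuki2012, status: disputed] -/
def logKummerCorrespondence {R : Type u} [CommRing R] (IQ : Submodule ℤ R) (M : ℤ → Type w)
    [∀ m, Monoid (M m)] (κ : ∀ m, M m →* R) : Prop :=
  (∀ m (x : M m), ∀ a ∈ IQ, κ m x * a ∈ IQ) ∧
    (⋃ m, Set.range (κ m)) = ⋃ m, Set.range (κ (m + 1))

/-- The translation-invariance clause of the log-Kummer correspondence holds for ANY `ℤ`-indexed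
family (re-indexing `m ↦ m + 1` is a bijection of `ℤ`) — so the content of Proposition 3.5 (ii) lies
in the action clause and in (a)–(c). PROVED. [claim: Mochizuki2012, status: disputed] -/
theorem iUnion_range_shift {R : Type u} (M : ℤ → Type w) (κ : ∀ m, M m → R) :
    (⋃ m, Set.range (κ m)) = ⋃ m, Set.range (κ (m + 1)) := by
  ext x
  simp only [Set.mem_iUnion, Set.mem_range]
  constructor
  · rintro ⟨m, y, rfl⟩
    refine ⟨m - 1, ?_⟩
    rw [sub_add_cancel]
    exact ⟨y, rfl⟩
  · rintro ⟨m, y, rfl⟩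
    exact ⟨m + 1, y, rfl⟩

/-! ### Proposition 3.5 (ii) log-Kummer correspondence — per-index form (appended) -/

/-- [IUTchIII] Proposition 3.5 (ii), final paragraph, p. 106 — PER-INDEX typing of the translation
invariance of the log-Kummer correspondence (the union-form clause of `logKummerCorrespondence` above is
formally true for every `ℤ`-family, `iUnion_range_shift`; cf. RQ7 finding T4-F1 of abc-iut-L6-t19 on the
sister statement in `GlobalKummerNonInterference.lean`): every Frobenius-like copy `(n,m)` of the unit
groups / splitting monoids has the SAME Kummer image in the coric ring ("invariant with respect to the
translation symmetries … of the `n`-th column"), and all of them act on `𝓘^ℚ`.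
[claim: Mochizuki2012, status: disputed] -/
def logKummerCorrespondence' {R : Type u} [CommRing R] (IQ : Submodule ℤ R) (M : ℤ → Type w)
    [∀ m, Monoid (M m)] (κ : ∀ m, M m →* R) : Prop :=
  (∀ m (x : M m), ∀ a ∈ IQ, κ m x * a ∈ IQ) ∧ ∀ m, Set.range (κ m) = Set.range (κ (m + 1))

/-- The per-index form implies the union form recorded earlier (and is strictly stronger) — PROVED.
[claim: Mochizuki2012, status: disputed] -/
theorem logKummerCorrespondence'.toUnion {R : Type u} [CommRing R] {IQ : Submodule ℤ R}
    {M : ℤ → Type w} [∀ m, Monoid (M m)] {κ : ∀ m, M m →* R}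
    (h : logKummerCorrespondence' IQ M κ) : logKummerCorrespondence IQ M κ :=
  ⟨h.1, iUnion_range_shift M (fun m => κ m)⟩

end Prop35

end Literature.IUT.LogThetaLattice
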